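import Summits.CriticalPhenomena.Ising3DConformalLimit.Theorems.ReflectionTwinExistsContinuousLimitClusterPointsMoebius
import HarnessLib

/-!
# K1′ in the tree's vocabulary: for cluster points, "inversion covariant with SOME positive weight" ⟺
# "inversion covariant with SOME exponent `Δ`" (crux `ExistsContinuousLimit`, stmt-CriticalPhenomena-4582, line `Sketch`;
# registered sub-goal `clusterPointInversionCovariant_iff_exists_exponent`)

The open stub K1′ `stub_clusterPointInversionCovariant` of line `Sketch` asks that every normalised cluster point `S` of
the pinned `ℤ³` zoom satisfy `S n (ι ∘ x) = (∏ w (x i)) · S n x` off the origin for SOME continuous positive weight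
`w`. For such `S` this is EQUIVALENT to `∃ Δ, IsInversionCovariant Δ S` (the inversion clause of item 4657
`ClusterRigidity.ClusterPointsMoebius`, weight `‖x‖^{2Δ}`): (⟹) is the landed weighted cocycle rigidity K2
`stub_inversionBegetsDilation` (p155681) fed with the free translation invariance / continuity of sequential limits and
the unconditional non-degeneracy of cluster points (p156060); (⟸) takes `w = ‖·‖^{2Δ}`. So K1′ is exactly "every
normalised cluster point is inversion covariant for some exponent" — the weaker-looking weighted form buys nothing and
costs nothing. [folklore]
-/

noncomputable section

namespace Summit.CriticalPhenomena.Ising3DConformalLimit.ReflectionTwinExistsContinuousLimit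

open Literature.Probability.LatticeModels Filter Set
open scoped Topology
open Summit.CriticalPhenomena.Ising3DConformalLimit.MoebiusLimitExistsOnlyInteraction (IsClusterPoint)
open Summit.CriticalPhenomena.Ising3DConformalLimit.Cruxes.ExistsScaleCovariantLimit.TwoHierarchies (continuousOn_seqLimit)

/-- The conformal weight `v ↦ ‖v‖^{2Δ}` is positive off the origin. [folklore] -/
theorem norm_rpow_weight_pos (Δ : ℝ) (v : EuclideanSpace ℝ (Fin 3)) (hv : v ≠ 0) : 0 < ‖v‖ ^ (2 * Δ) :=
  Real.rpow_pos_of_pos (norm_pos_iff.2 hv) _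

/-- The conformal weight `v ↦ ‖v‖^{2Δ}` is continuous off the origin. [folklore] -/
theorem norm_rpow_weight_continuousOn (Δ : ℝ) :
    ContinuousOn (fun v : EuclideanSpace ℝ (Fin 3) => ‖v‖ ^ (2 * Δ)) {0}ᶜ := by
  intro v hv
  have hv0 : ‖v‖ ≠ 0 := norm_ne_zero_iff.2 hv
  exact (continuous_norm.continuousAt.rpow_const (Or.inl hv0)).continuousWithinAt

/-- **Registered sub-goal `clusterPointInversionCovariant_iff_exists_exponent`: for a normalised cluster point of the
pinned `ℤ³` zoom, covariance under the unit inversion with SOME continuous positive weight is equivalent to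
`∃ Δ, IsInversionCovariant Δ S`.** [folklore] -/
theorem clusterPointInversionCovariant_iff_exists_exponent :
    ∀ S : Literature.Probability.LatticeModels.CorrFamily 3,
      (∀ n z, z ∉ Literature.Probability.LatticeModels.NonCoincident 3 n → S n z = 0) →
      Summit.CriticalPhenomena.Ising3DConformalLimit.MoebiusLimitExistsOnlyInteraction.IsClusterPoint S →
      ((∃ w : EuclideanSpace ℝ (Fin 3) → ℝ, (∀ v, v ≠ 0 → 0 < w v) ∧ ContinuousOn w {0}ᶜ ∧
          ∀ (n : ℕ) (x : Fin n → EuclideanSpace ℝ (Fin 3)), (∀ i, x i ≠ 0) →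
            S n (fun i => EuclideanGeometry.inversion (0 : EuclideanSpace ℝ (Fin 3)) 1 (x i)) =
              (∏ i, w (x i)) * S n x) ↔
        ∃ Δ : ℝ, Literature.Probability.LatticeModels.IsInversionCovariant Δ S) := by
  intro S hN hS
  constructor
  · rintro ⟨w, hwpos, hwcont, hcov⟩
    have hnd : IsNondegenerateTwoPoint S := clusterPoint_isNondegenerateTwoPoint S hS
    have htr : IsTranslationInvariant S := isTranslationInvariant_of_isClusterPoint hN hS
    have hcont : ∀ n, ContinuousOn (S n) (NonCoincident 3 n) := by
      obtain ⟨u, hu, hconv⟩ := hS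
      exact fun n => continuousOn_seqLimit hu (hconv n)
    obtain ⟨Δ, -, hinv⟩ := stub_inversionBegetsDilation S hN hcont htr hnd w hwpos hwcont hcov
    exact ⟨Δ, hinv⟩
  · rintro ⟨Δ, hinv⟩
    exact ⟨fun v => ‖v‖ ^ (2 * Δ), norm_rpow_weight_pos Δ, norm_rpow_weight_continuousOn Δ,
      fun n x hx => hinv n x hx⟩

end Summit.CriticalPhenomena.Ising3DConformalLimit.ReflectionTwinExistsContinuousLimit

end
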